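import Summits.AtomisticToContinuum.Crystallization.Theses.PricedLinkCensus

/-!
# Route PricedLinkCensus — lemmas on the words of Barlow stackings, for the hinge `StackingHinge`
(stmt-AtomisticToContinuum-14238)

Elementary facts about `barlowStacking a c s` as a function of its Hägg word `s` and its scale
`(a, c)`, used by the word-and-scale selection theorem of
`PricedLinkCensusStackingHingeWordSelection.lean` (step (b)/(c) of the planner's plan for
`StackingHinge`):

* §1 RE-BASING: every point `z₀ = barlowPos a c s m i₀ j₀` of a Barlow stacking is the origin of
  the stacking of the shifted word `s(· + m)` — `z ∈ barlowStacking a c s ↔ z - z₀ ∈ barlowStacking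
  a c (s(· + m))` (`mem_barlowStacking_iff_sub_mem_shift`, from `haggLabel_shift`,
  `barlowPos_add_barlowPos_shift`); LOCALITY: the points of norm `≤ L |c|` only depend on the
  letters `s n`, `-L ≤ n ≤ L` (`mem_barlowStacking_of_eqOn`, from `haggLabel_congr`).
  (The re-basing lemmas parallel `CLayerWitnessLayeringIdeal.haggLabel_shift` /
  `barlowStacking_eq_image_shift` of `ThreeConeCertificateSlackRigidityLayeringIdeal.lean`; they
  are restated in the `z - z₀` form used downstream to keep this file's imports inside the route.)
* §2 SCALE PERTURBATION: two Barlow points with equal indices and labels at scales `(a, c)`,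
  `(a', c')` are within `(|a - a'|/|a| + |c - c'|/|c|) ‖z‖` (`dist_barlowPos_le_of_haggLabel_eq`);
  finite `δ`-nets of an interval indexed by a `Fin` type (`exists_fin_net_point`); a union bound
  for `Nat.card` (`natCard_exists_le_sum_natCard`).

All `[folklore]`.
-/

namespace Summit.AtomisticToContinuum.Crystallization.Theorems

open Literature.MathematicalPhysics.StatisticalMechanics
open Filter Topology

/-! ### §1 Shifting and localising the word of a Barlow stacking -/

/-- **Label function of a shifted word**: `L_{s(·+m)}(k) = L_s(k + m) - L_s(m)`. [folklore] -/
theorem haggLabel_shift (s : ℤ → ℤ) (m k : ℤ) :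
    haggLabel (fun n => s (n + m)) k = haggLabel s (k + m) - haggLabel s m := by
  induction k using Int.induction_on with
  | zero => simp
  | succ k ih =>
    rw [haggLabel_succ, ih, show (k : ℤ) + 1 + m = (k + m) + 1 by ring, haggLabel_succ]
    ring
  | pred k ih =>
    have h1 := haggLabel_succ (fun n => s (n + m)) (-(k : ℤ) - 1)
    have h2 := haggLabel_succ s (-(k : ℤ) - 1 + m)
    rw [show -(k : ℤ) - 1 + 1 = -k by ring, ih] at h1
    rw [show -(k : ℤ) - 1 + m + 1 = -k + m by ring] at h2
    linarith

/-- **Re-basing a Barlow stacking**: the point `(k, i, j)` of the stacking of the shifted word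
`s(· + m)`, translated by the point `(m, i₀, j₀)` of the stacking of `s`, is the point
`(k + m, i + i₀, j + j₀)` of the latter. [folklore] -/
theorem barlowPos_add_barlowPos_shift (a c : ℝ) (s : ℤ → ℤ) (m i₀ j₀ k i j : ℤ) :
    barlowPos a c s m i₀ j₀ + barlowPos a c (fun n => s (n + m)) k i j =
      barlowPos a c s (k + m) (i + i₀) (j + j₀) := by
  simp only [barlowPos, haggLabel_shift, Int.cast_add, Int.cast_sub]
  module

/-- **Every point of a Barlow stacking is a base point**: `z ∈ barlowStacking a c s` iff
`z - z₀` lies in the stacking of the shifted word `s(· + m)`, for any point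
`z₀ = barlowPos a c s m i₀ j₀` of the stacking. [folklore] -/
theorem mem_barlowStacking_iff_sub_mem_shift {a c : ℝ} {s : ℤ → ℤ} {m i₀ j₀ : ℤ}
    (z : EuclideanSpace ℝ (Fin 3)) :
    z ∈ barlowStacking a c s ↔
      z - barlowPos a c s m i₀ j₀ ∈ barlowStacking a c (fun n => s (n + m)) := by
  constructor
  · rintro ⟨k, i, j, rfl⟩
    refine ⟨k - m, i - i₀, j - j₀, ?_⟩
    rw [sub_eq_iff_eq_add', barlowPos_add_barlowPos_shift]
    simp
  · rintro ⟨k, i, j, hk⟩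
    rw [sub_eq_iff_eq_add'] at hk
    rw [hk, barlowPos_add_barlowPos_shift]
    exact barlowPos_mem _ _ _

/-- A shifted Hägg word is a Hägg word. [folklore] -/
theorem isHaggSeq_shift {s : ℤ → ℤ} (hs : IsHaggSeq s) (m : ℤ) : IsHaggSeq fun n => s (n + m) :=
  fun n => hs (n + m)

/-- **Labels are local**: words agreeing on `[-L, L]` have the same labels `L_s(k)`, `|k| ≤ L`.
[folklore] -/
theorem haggLabel_congr {s s' : ℤ → ℤ} {L : ℕ} (h : ∀ n : ℤ, -(L : ℤ) ≤ n → n ≤ L → s n = s' n)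
    {k : ℤ} (hk₁ : -(L : ℤ) ≤ k) (hk₂ : k ≤ L) : haggLabel s k = haggLabel s' k := by
  rcases le_or_gt 0 k with h0 | h0
  · lift k to ℕ using h0
    rw [haggLabel_natCast, haggLabel_natCast, haggWindow, haggWindow]
    refine Finset.sum_congr rfl fun i hi => h _ (by omega) ?_
    rw [Finset.mem_range] at hi
    omega
  · obtain ⟨n, rfl⟩ : ∃ n : ℕ, k = -(n : ℤ) := ⟨(-k).toNat, by omega⟩
    rw [haggLabel_neg_natCast, haggLabel_neg_natCast, haggWindow, haggWindow]
    congr 1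
    refine Finset.sum_congr rfl fun i hi => h _ (by omega) ?_
    rw [Finset.mem_range] at hi
    omega

/-- **Stackings are local in the word**: if the words `s, s'` agree on `[-L, L]` and `c ≠ 0`, the
two stackings have the same points in the ball `‖z‖ ≤ L |c|` (such a point lies in a layer `m`
with `|m| ≤ L`, whose position only involves the letters `s n`, `-L ≤ n < L`). [folklore] -/
theorem mem_barlowStacking_of_eqOn {a c : ℝ} (hc : c ≠ 0) {s s' : ℤ → ℤ} {L : ℕ}
    (h : ∀ n : ℤ, -(L : ℤ) ≤ n → n ≤ L → s n = s' n) {z : EuclideanSpace ℝ (Fin 3)}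
    (hz : ‖z‖ ≤ L * |c|)
    (hzs : z ∈ barlowStacking a c s) : z ∈ barlowStacking a c s' := by
  obtain ⟨k, i, j, rfl⟩ := hzs
  have h2 : |(k : ℝ) * c| ≤ L * |c| := by
    have h2' : ‖(barlowPos a c s k i j) 2‖ ≤ ‖barlowPos a c s k i j‖ := PiLp.norm_apply_le _ 2
    rw [barlowPos_apply_two, Real.norm_eq_abs] at h2'
    exact h2'.trans hz
  have hk : |(k : ℝ)| ≤ L := by
    rw [abs_mul] at h2
    exact le_of_mul_le_mul_right h2 (abs_pos.2 hc)
  rw [abs_le] at hk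
  have hk₁ : -(L : ℤ) ≤ k := by exact_mod_cast hk.1
  have hk₂ : k ≤ (L : ℤ) := by exact_mod_cast hk.2
  refine ⟨k, i, j, ?_⟩
  simp only [barlowPos, haggLabel_congr h hk₁ hk₂]

/-- Union bound for `Nat.card` over a finite family of predicates. [folklore] -/
theorem natCard_exists_le_sum_natCard {ι W : Type*} [Finite ι] [Fintype W] (P : W → ι → Prop) :
    (Nat.card {i // ∃ w, P w i} : ℝ) ≤ ∑ w, (Nat.card {i // P w i} : ℝ) := by
  classical
  let F : {i // ∃ w, P w i} → Σ w, {i // P w i} := fun i =>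
    ⟨i.2.choose, ⟨i.1, i.2.choose_spec⟩⟩
  have hF : Function.Injective F := fun i j hij => Subtype.ext (by
    have := congrArg (fun p : Σ w, {i // P w i} => (p.2.1 : ι)) hij
    exact this)
  have h1 := Nat.card_le_card_of_injective F hF
  rw [Nat.card_sigma] at h1
  exact_mod_cast h1

/-! ### §2 Perturbing the scale; finite nets; a union bound -/

/-- **Scale perturbation.**  Two Barlow points with the same indices `(m, i, j)` and the same
layer label, at scales `(a, c)` and `(a', c')` (`a, c ≠ 0`), are within
`(|a - a'| / |a| + |c - c'| / |c|) · ‖z‖` of each other, `z` the first point: the difference is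
the first point with its horizontal coordinates multiplied by `(a - a')/a` and its vertical one by
`(c - c')/c`. [folklore] -/
theorem dist_barlowPos_le_of_haggLabel_eq {a a' c c' : ℝ} (ha : a ≠ 0) (hc : c ≠ 0)
    {s s' : ℤ → ℤ} {m : ℤ} (hL : haggLabel s m = haggLabel s' m) (i j : ℤ) :
    dist (barlowPos a c s m i j) (barlowPos a' c' s' m i j) ≤
      (|a - a'| / |a| + |c - c'| / |c|) * ‖barlowPos a c s m i j‖ := by
  set z := barlowPos a c s m i j with hz
  set z' := barlowPos a' c' s' m i j with hz'
  set μ := |a - a'| / |a| + |c - c'| / |c| with hμ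
  have hμ0 : 0 ≤ μ := by positivity
  have hμa : |a - a'| / |a| ≤ μ := le_add_of_nonneg_right (by positivity)
  have hμc : |c - c'| / |c| ≤ μ := le_add_of_nonneg_left (by positivity)
  have h0 : (z - z') 0 = (a - a') / a * z 0 := by
    simp only [hz, hz', PiLp.sub_apply, barlowPos_apply_zero, hL]
    field_simp
  have h1 : (z - z') 1 = (a - a') / a * z 1 := by
    simp only [hz, hz', PiLp.sub_apply, barlowPos_apply_one, hL]
    field_simp
  have h2 : (z - z') 2 = (c - c') / c * z 2 := by
    simp only [hz, hz', PiLp.sub_apply, barlowPos_apply_two]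
    field_simp
  have key : ∀ l : Fin 3, ‖(z - z') l‖ ^ 2 ≤ (μ * ‖z l‖) ^ 2 := by
    intro l
    rw [Real.norm_eq_abs, Real.norm_eq_abs]
    refine pow_le_pow_left₀ (abs_nonneg _) ?_ 2
    fin_cases l
    · show |(z - z') 0| ≤ μ * |z 0|
      rw [h0, abs_mul, abs_div]
      exact mul_le_mul_of_nonneg_right hμa (abs_nonneg _)
    · show |(z - z') 1| ≤ μ * |z 1|
      rw [h1, abs_mul, abs_div]
      exact mul_le_mul_of_nonneg_right hμa (abs_nonneg _)
    · show |(z - z') 2| ≤ μ * |z 2|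
      rw [h2, abs_mul, abs_div]
      exact mul_le_mul_of_nonneg_right hμc (abs_nonneg _)
  rw [dist_eq_norm, EuclideanSpace.norm_eq, EuclideanSpace.norm_eq z]
  calc √(∑ l, ‖(z - z') l‖ ^ 2) ≤ √(∑ l, (μ * ‖z l‖) ^ 2) :=
        Real.sqrt_le_sqrt (Finset.sum_le_sum fun l _ => key l)
    _ = μ * √(∑ l, ‖z l‖ ^ 2) := by
        simp_rw [mul_pow, ← Finset.mul_sum]
        rw [Real.sqrt_mul (sq_nonneg μ), Real.sqrt_sq hμ0]

/-- **Finite `δ`-nets of an interval.**  Every `t ∈ [lo, hi]` lies within `δ` above a net point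
`lo + n δ ≤ t`, `n ≤ ⌈(hi - lo)/δ⌉₊` (so the net points are indexed by a `Fin` type and lie in
`[lo, hi]`). [folklore] -/
theorem exists_fin_net_point {lo hi δ t : ℝ} (hδ : 0 < δ) (ht : t ∈ Set.Icc lo hi) :
    ∃ n : Fin (⌈(hi - lo) / δ⌉₊ + 1), lo + (n : ℕ) * δ ≤ t ∧ t ≤ lo + (n : ℕ) * δ + δ := by
  obtain ⟨hlo, hhi⟩ := ht
  have h0 : 0 ≤ (t - lo) / δ := div_nonneg (by linarith) hδ.le
  refine ⟨⟨⌊(t - lo) / δ⌋₊, ?_⟩, ?_, ?_⟩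
  · refine Nat.lt_succ_of_le (Nat.floor_le_ceil _ |>.trans (Nat.ceil_mono ?_))
    exact div_le_div_of_nonneg_right (by linarith) hδ.le
  · have := Nat.floor_le h0
    rw [le_div_iff₀ hδ] at this
    simp only
    linarith
  · have := Nat.lt_floor_add_one ((t - lo) / δ)
    rw [div_lt_iff₀ hδ] at this
    simp only
    linarith

end Summit.AtomisticToContinuum.Crystallization.Theorems
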